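import Summits.Ventures.LatticeQCDFlow.Scaling.ExchangeSchemeCollector
import Summits.Ventures.LatticeQCDFlow.Scaling.HubAcceptanceLaw
import Summits.Ventures.LatticeQCDFlow.Scaling.HubCollectorLaw

/-!
HONEST FRAMING: exact (Metropolis-corrected) sampling algorithms for lattice gauge theory; figures
of merit are autocorrelation/cost numbers at stated couplings and volumes; no continuum-physics
claim.

# DominatedStarEntrySwap — THE ENTRY SWAP OF THE MAP-ASSISTED HUB IN ACCEPT/REJECT FORM, AND THE REGENERATION
# WEIGHTS: UNDER ONE-SIDED DOMINATION `p·μ_l(φ_r u) ≤ μ_0(u)` THE ACCEPTED MOVE CARRIES A PART OF WEIGHT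
# `β_r(z) = p·μ_l(φ_r z_0)/μ_0(z_0) ≤ α_r(z)`; UNDER `q·μ_0(u) ≤ μ_l(φ_r u)` A PART `β'_r(z) = q·μ_0(φ_r⁻¹ z_l)/μ_l(z_l) ≤ α_r(z)`
# (lean-2 GEN-25, ours)

Venture-side (OURS).  Cell `lqcd-flow` (pub-lqcd), unit `pub-lqcd-lean-2-g25`, 2026-08-27.  Chapter M (the
coupon-collector ceiling without perfect transports), file 3.  Hub list `e_r = (0, κ_r + 1)` with maps `φ_r`, positive
laws `μ_k`; the entry proposal `y_r(z) = edgeFlowSwap φ_r 0 l z` (`l = κ_r+1`) and its Metropolis kernel for the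
product law `π̃ = ⊗μ_k` (`Scaling/ExchangeSchemeCollector` shows that the graph swap `GSw` is the average of these).
The acceptance is `α_r(z) = min{1, π̃(y_r z)/π̃(z)}`, carried as a hypothesis-equation, and the two REGENERATION
WEIGHTS are `β_r(z) = p·μ_l(φ_r z_0)/μ_0(z_0)` and `β'_r(z) = q·μ_0(φ_r⁻¹ z_l)/μ_l(z_l)`: the first is the part of the
accepted move onto `l` that — averaged over a hot value `z_0 ∼ μ_0` — deposits an exactly `μ_l`-distributed value at
`l` whatever the old value was (Nummelin splitting), the second the same with the roles of `0` and `l` exchanged.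

## What is proved

* §1 `entrySwap_entrySwap`; **`entrySwap_eq_accept_reject`** — `Met_r(z,z') = α_r(z)𝟙{z'=y_r z} + (1−α_r(z))𝟙{z'=z}`;
  **`accept_mul_pair`** — `α_r(z)·μ_0(z_0)μ_l(z_l) = min{μ_0(z_0)μ_l(z_l), μ_0(φ_r⁻¹z_l)μ_l(φ_r z_0)}`;
  **`regenWeight_le_accept`** (`0 ≤ β_r ≤ α_r` under `p·μ_l(φ_r u) ≤ μ_0(u)`), **`regenWeight'_le_accept`**
  (`0 ≤ β'_r ≤ α_r` under `q·μ_0(u) ≤ μ_l(φ_r u)`), `accept_mem`, and **`goodWeight_le_accept`** — the good-tag weight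
  `γ_r(z,D) ∈ {α_r(z), β_r(z), β'_r(z), 0}` of the sequel satisfies `0 ≤ γ_r ≤ α_r`.

Reading (no numerics implied): the one-sided domination constant of chapter J is exactly what makes a fresh hub
value regenerate a stale cold replica with probability `p` per accepted-or-not swap attempt.  NOT CLAIMED here:
anything about the chain (files 4–6).  Literature grade (cell rule): OWN COMPOSITION; nothing cited as a fact; no new
bib keys.
-/

noncomputable section

open Finset Function
open Literature.Probability.MarkovChains

namespace Summit.Ventures.LatticeQCDFlow.Scaling

variable {S : Type*} [Fintype S] [DecidableEq S] {K m : ℕ} {μ : Fin (K + 1) → S → ℝ} {M : Fin (K + 1) → S → S → ℝ}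
  {w : Fin (K + 1) → ℝ} {t p q : ℝ}

section Aug
variable (κ : Fin m → Fin K) (φ : Fin m → Equiv.Perm S)

/-! ## §1 The entry swap in accept/reject form; regeneration weights -/

omit [Fintype S] [DecidableEq S] in
/-- The proposal `y_r(z)` is an involution of the configuration space. [ours] -/
theorem entrySwap_entrySwap (r : Fin m) (z : Fin (K + 1) → S) :
    edgeFlowSwap (φ r) 0 (κ r).succ (edgeFlowSwap (φ r) 0 (κ r).succ z) = z :=
  edgeFlowSwap_edgeFlowSwap (φ r) (hubList_fst_ne_snd (K := K) κ r) z

/-- **THE ENTRY METROPOLIS KERNEL IN ACCEPT/REJECT FORM:** with `α_r(z) = min{1, π̃(y_r z)/π̃(z)}`,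
`Met_r(z,z') = α_r(z)·𝟙{z' = y_r z} + (1 − α_r(z))·𝟙{z' = z}` (`μ > 0`; both readings agree when `y_r z = z`). [ours] -/
theorem entrySwap_eq_accept_reject (hμ : ∀ k x, 0 < μ k x) {α : Fin m → (Fin (K + 1) → S) → ℝ}
    (hα : ∀ r z, α r z = min 1 (tensorFun μ (edgeFlowSwap (φ r) 0 (κ r).succ z) / tensorFun μ z))
    (r : Fin m) (z z' : Fin (K + 1) → S) :
    mhKernel (fun a b => if b = edgeFlowSwap (φ r) 0 (κ r).succ a then (1 : ℝ) else 0) (tensorFun μ) z z'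
      = α r z * (if z' = edgeFlowSwap (φ r) 0 (κ r).succ z then (1 : ℝ) else 0)
        + (1 - α r z) * (if z' = z then (1 : ℝ) else 0) := by
  have hπ := tensorFun_pos hμ
  have hinv := entrySwap_entrySwap κ φ r
  set y := edgeFlowSwap (φ r) 0 (κ r).succ z with hy
  -- the off-diagonal rate: `mhRate z z'' = 𝟙{z'' = y}·α` for `z'' ≠ z`
  have hrate : ∀ z'' : Fin (K + 1) → S, z'' ≠ z →
      mhRate (fun a b => if b = edgeFlowSwap (φ r) 0 (κ r).succ a then (1 : ℝ) else 0) (tensorFun μ) z z''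
        = if z'' = y then α r z else 0 := by
    intro z'' hz''
    unfold mhRate
    dsimp only
    by_cases h : z'' = y
    · rw [if_pos h, if_pos h, h, if_pos (by rw [hy, hinv z]), mul_one, hα, hy]
    · rw [if_neg h, if_neg h, if_neg (fun h' => h (by rw [hy, h', hinv])), mul_zero, zero_div, min_self]
  by_cases hzz : z' = z
  · subst hzz
    rw [mhKernel_self, if_pos rfl, mul_one]
    rw [Finset.sum_congr rfl (fun z'' hz'' => hrate z'' (Finset.ne_of_mem_erase hz''))]
    by_cases hyz : y = z'
    · -- the proposal is the current state: nothing moves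
      have : ∑ x ∈ univ.erase z', (if x = y then α r z' else 0) = 0 :=
        sum_eq_zero fun x hx => if_neg (fun h => Finset.ne_of_mem_erase hx (h.trans hyz))
      rw [this, if_pos hyz.symm]; ring
    · rw [Finset.sum_ite_eq' (univ.erase z') y, if_pos (Finset.mem_erase.mpr ⟨hyz, mem_univ _⟩),
        if_neg (Ne.symm hyz)]; ring
  · rw [mhKernel_of_ne hzz, hrate z' hzz, if_neg hzz, mul_zero, add_zero]
    split_ifs <;> ring

omit [Fintype S] [DecidableEq S] in
/-- **The acceptance against the pair weights:** `α_r(z)·μ_0(z_0)μ_l(z_l) = min{μ_0(z_0)μ_l(z_l), μ_0(φ_r⁻¹ z_l)μ_l(φ_r z_0)}`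
(`μ > 0`). [ours] -/
theorem accept_mul_pair [Fintype S] (hμ : ∀ k x, 0 < μ k x) {α : Fin m → (Fin (K + 1) → S) → ℝ}
    (hα : ∀ r z, α r z = min 1 (tensorFun μ (edgeFlowSwap (φ r) 0 (κ r).succ z) / tensorFun μ z))
    (r : Fin m) (z : Fin (K + 1) → S) :
    α r z * (μ 0 (z 0) * μ (κ r).succ (z (κ r).succ))
      = min (μ 0 (z 0) * μ (κ r).succ (z (κ r).succ)) (μ 0 ((φ r).symm (z (κ r).succ)) * μ (κ r).succ (φ r (z 0))) := by
  have hπ := tensorFun_pos hμ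
  have hil := hubList_fst_ne_snd (K := K) κ r
  have hA : 0 < μ 0 (z 0) * μ (κ r).succ (z (κ r).succ) := mul_pos (hμ _ _) (hμ _ _)
  have hratio : tensorFun μ (edgeFlowSwap (φ r) 0 (κ r).succ z) / tensorFun μ z
      = μ 0 ((φ r).symm (z (κ r).succ)) * μ (κ r).succ (φ r (z 0)) / (μ 0 (z 0) * μ (κ r).succ (z (κ r).succ)) := by
    rw [div_eq_div_iff (hπ z).ne' hA.ne']
    have h := tensorFun_edgeFlowSwap_mul μ (φ r) hil z
    linarith [h]
  rw [hα, hratio, min_mul_of_nonneg _ _ hA.le, one_mul, div_mul_cancel₀ _ hA.ne']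

omit [Fintype S] [DecidableEq S] in
/-- **THE FORWARD REGENERATION WEIGHT IS BELOW THE ACCEPTANCE:** under `p·μ_l(φ_r u) ≤ μ_0(u)` for all `u`
(`0 ≤ p`, `μ > 0`), `β_r(z) = p·μ_l(φ_r z_0)/μ_0(z_0)` satisfies `0 ≤ β_r(z) ≤ α_r(z)`. [ours] -/
theorem regenWeight_le_accept [Fintype S] (hμ : ∀ k x, 0 < μ k x) (hp0 : 0 ≤ p)
    {α : Fin m → (Fin (K + 1) → S) → ℝ}
    (hα : ∀ r z, α r z = min 1 (tensorFun μ (edgeFlowSwap (φ r) 0 (κ r).succ z) / tensorFun μ z))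
    {β : Fin m → (Fin (K + 1) → S) → ℝ} (hβ : ∀ r z, β r z = p * μ (κ r).succ (φ r (z 0)) / μ 0 (z 0))
    (r : Fin m) (hdom : ∀ u, p * μ (κ r).succ (φ r u) ≤ μ 0 u) (z : Fin (K + 1) → S) :
    0 ≤ β r z ∧ β r z ≤ α r z := by
  have h0 := hμ 0 (z 0)
  have hl := hμ (κ r).succ (z (κ r).succ)
  refine ⟨by rw [hβ]; exact div_nonneg (mul_nonneg hp0 (hμ _ _).le) h0.le, ?_⟩
  -- multiply by the pair weight `μ_0(z_0)μ_l(z_l) > 0`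
  have hA : 0 < μ 0 (z 0) * μ (κ r).succ (z (κ r).succ) := mul_pos h0 hl
  refine le_of_mul_le_mul_right ?_ hA
  rw [accept_mul_pair κ φ hμ hα r z, hβ]
  have e : p * μ (κ r).succ (φ r (z 0)) / μ 0 (z 0) * (μ 0 (z 0) * μ (κ r).succ (z (κ r).succ))
      = p * μ (κ r).succ (φ r (z 0)) * μ (κ r).succ (z (κ r).succ) := by field_simp
  rw [e]
  refine le_min ?_ ?_
  · exact mul_le_mul_of_nonneg_right (hdom (z 0)) hl.le
  · -- `p·μ_l(z_l) ≤ μ_0(φ⁻¹ z_l)` is the domination at `u = φ⁻¹ z_l`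
    have h := hdom ((φ r).symm (z (κ r).succ))
    rw [Equiv.apply_symm_apply] at h
    nlinarith [(hμ (κ r).succ (φ r (z 0))).le]

omit [Fintype S] [DecidableEq S] in
/-- **THE REVERSE REGENERATION WEIGHT IS BELOW THE ACCEPTANCE:** under `q·μ_0(u) ≤ μ_l(φ_r u)` for all `u`
(`0 ≤ q`, `μ > 0`), `β'_r(z) = q·μ_0(φ_r⁻¹ z_l)/μ_l(z_l)` satisfies `0 ≤ β'_r(z) ≤ α_r(z)`. [ours] -/
theorem regenWeight'_le_accept [Fintype S] (hμ : ∀ k x, 0 < μ k x) (hq0 : 0 ≤ q)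
    {α : Fin m → (Fin (K + 1) → S) → ℝ}
    (hα : ∀ r z, α r z = min 1 (tensorFun μ (edgeFlowSwap (φ r) 0 (κ r).succ z) / tensorFun μ z))
    {β' : Fin m → (Fin (K + 1) → S) → ℝ}
    (hβ' : ∀ r z, β' r z = q * μ 0 ((φ r).symm (z (κ r).succ)) / μ (κ r).succ (z (κ r).succ))
    (r : Fin m) (hrev : ∀ u, q * μ 0 u ≤ μ (κ r).succ (φ r u)) (z : Fin (K + 1) → S) :
    0 ≤ β' r z ∧ β' r z ≤ α r z := by
  have h0 := hμ 0 (z 0)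
  have hl := hμ (κ r).succ (z (κ r).succ)
  refine ⟨by rw [hβ']; exact div_nonneg (mul_nonneg hq0 (hμ _ _).le) hl.le, ?_⟩
  have hA : 0 < μ 0 (z 0) * μ (κ r).succ (z (κ r).succ) := mul_pos h0 hl
  refine le_of_mul_le_mul_right ?_ hA
  rw [accept_mul_pair κ φ hμ hα r z, hβ']
  have e : q * μ 0 ((φ r).symm (z (κ r).succ)) / μ (κ r).succ (z (κ r).succ) * (μ 0 (z 0) * μ (κ r).succ (z (κ r).succ))
      = q * μ 0 ((φ r).symm (z (κ r).succ)) * μ 0 (z 0) := by field_simp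
  rw [e]
  refine le_min ?_ ?_
  · -- `q·μ_0(φ⁻¹ z_l) ≤ μ_l(z_l)` is the reverse domination at `u = φ⁻¹ z_l`
    have h := hrev ((φ r).symm (z (κ r).succ))
    rw [Equiv.apply_symm_apply] at h
    nlinarith [h0.le]
  · have h := hrev (z 0)
    nlinarith [(hμ 0 ((φ r).symm (z (κ r).succ))).le]

omit [Fintype S] [DecidableEq S] in
/-- The acceptance lies in `[0,1]` (`μ > 0`). [ours] -/
theorem accept_mem [Fintype S] (hμ : ∀ k x, 0 < μ k x) {α : Fin m → (Fin (K + 1) → S) → ℝ}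
    (hα : ∀ r z, α r z = min 1 (tensorFun μ (edgeFlowSwap (φ r) 0 (κ r).succ z) / tensorFun μ z))
    (r : Fin m) (z : Fin (K + 1) → S) : 0 ≤ α r z ∧ α r z ≤ 1 := by
  have hπ := tensorFun_pos hμ
  rw [hα]
  exact ⟨le_min zero_le_one (div_nonneg (hπ _).le (hπ _).le), min_le_left _ _⟩

omit [Fintype S] [DecidableEq S] in
/-- **`0 ≤ γ_r(z,D) ≤ α_r(z)`** for the good-tag weight under both dominations. [ours] -/
theorem goodWeight_le_accept [Fintype S] (hμ : ∀ k x, 0 < μ k x) (hp0 : 0 ≤ p) (hq0 : 0 ≤ q)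
    {α : Fin m → (Fin (K + 1) → S) → ℝ}
    (hα : ∀ r z, α r z = min 1 (tensorFun μ (edgeFlowSwap (φ r) 0 (κ r).succ z) / tensorFun μ z))
    {β : Fin m → (Fin (K + 1) → S) → ℝ} (hβ : ∀ r z, β r z = p * μ (κ r).succ (φ r (z 0)) / μ 0 (z 0))
    {β' : Fin m → (Fin (K + 1) → S) → ℝ}
    (hβ' : ∀ r z, β' r z = q * μ 0 ((φ r).symm (z (κ r).succ)) / μ (κ r).succ (z (κ r).succ))
    {γ : Fin m → (Fin (K + 1) → S) × Finset (Fin (K + 1)) → ℝ}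
    (hγ : ∀ r a, γ r a = if (0 : Fin (K + 1)) ∉ a.2 then (if (κ r).succ ∉ a.2 then α r a.1 else β r a.1)
      else (if (κ r).succ ∉ a.2 then β' r a.1 else 0))
    (hdom : ∀ r u, p * μ (κ r).succ (φ r u) ≤ μ 0 u) (hrev : ∀ r u, q * μ 0 u ≤ μ (κ r).succ (φ r u))
    (r : Fin m) (a : (Fin (K + 1) → S) × Finset (Fin (K + 1))) : 0 ≤ γ r a ∧ γ r a ≤ α r a.1 := by
  have hαm := accept_mem κ φ hμ hα r a.1
  have hb := regenWeight_le_accept κ φ hμ hp0 hα hβ r (hdom r) a.1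
  have hb' := regenWeight'_le_accept κ φ hμ hq0 hα hβ' r (hrev r) a.1
  rw [hγ]
  split_ifs
  · exact ⟨le_rfl, hαm.1⟩
  · exact hb'
  · exact hb
  · exact ⟨hαm.1, le_rfl⟩

end Aug

end Summit.Ventures.LatticeQCDFlow.Scaling

end
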